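import Summits.ABC.IUTFork.Joshi.ThetaLociTensorPackets
import Summits.ABC.IUTFork.Joshi.ATS3FundamentalEstimate
import Mathlib.Algebra.BigOperators.Finprod
import HarnessLib

/-!
# Joshi, *Arithmetic Teichmüller Spaces III* (arXiv:2401.13508v4) §9.8.2: the SIZES of the theta-values loci —
# (9.8.2.1)–(9.8.2.5), Remark 9.8.2.3, Corollary 9.8.2.6, Lemma 9.8.2.7 — TYPED; projection to `ATS3.LocusDatum`

Sequel of `Joshi/ThetaLociTensorPackets.lean` (abc-iut cell, branch E, rung LADDER-ABC:A2.E; seat abc-iut-E-t22, slot T-22,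
OBJECTS.tsv O-043) over the same signature `ATS3.TensorPacketLociDatum`. Source: K. Joshi, arXiv:2401.13508 **v4** («Preliminary
version for comments», UNREFEREED; bib `Joshi2024ATS3`; rejected by the IUT author, `Mochizuki2024JoshiReport`), §9.8.2
p.117 l.7 – p.119 l.22 of the render `HOME/lit/renders/Joshi-arxiv-2401.13508/pNNNN.txt` («p.N l.M» = line M of page N).
**No side is taken**; every statement print ASSERTS is a `Prop`-valued READING PREDICATE `@[claim "Joshi2024ATS3" "disputed"]`
(the registered word recording that a dispute exists in print); PROVED is only what follows from the signature.
TYPED ≠ PROVED ≠ ENDORSED.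

As printed: (9.8.2.1) for an arithmeticoid `y = (y_w)`, `|log_BK(ξ_y)| = ∏_{w ∈ 𝕍_{L′}} |log_BK(ξ_{y,w})|_{K_{y_w}} =
∏_{w ∈ 𝕍^{odd,ss}} |log_BK(ξ_{y,w})|_{K_{y_w}}` (p.117 l.15–36); (9.8.2.2) `|log_BK(ξ^{Joshi}_z)| = ∏_{j=1}^{ℓ*} |log_BK(ξ_{y_j})|`,
«and similarly define `|log_BK(ξ^{Mochizuki}_z)|`» (l.37–62); Rmk. 9.8.2.3 «by Lemma 9.8.2.7, `|log_p(1+p*_w)|_{L′_w} = |p*_w|` …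
So `log_BK(1+p*)` contributes an element of unit norm» (l.63–80); (9.8.2.4) `|Θ̃^{Ĩ}_Joshi| = sup_{z ∈ Σ̃_{L′}} {|log_BK(ξ^J_z)|}`,
(9.8.2.5) `|Θ̃^{Ĩ}_Mochizuki| = sup_{z ∈ Σ̃_{L′}} {|log_BK(ξ^M_z)|}` (l.81–108); «Similarly one defines, using tensor product norms
on local factors, the quantities `|Θ̃^{𝓘}_Joshi|`, `|Θ̃^{𝓘}_Mochizuki|` as the suprema of the (tensor product) norms of the images
of elements of `Θ̃^{Ĩ}`» (l.109–126); Cor. 9.8.2.6 «The four suprema … are bounded. Proof. This is clear from Corollary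
9.8.1.3» (l.127–158); Lemma 9.8.2.7 «Let `E` be a p-adic field … for all `x ∈ (p*·𝒪_E) − {0}` one has `|log_E(1+x)|_E =
|x|_E`» (l.159–161; proof p.118 – p.119 l.22, [Koblitz 1984]).

FLAG (iii) of the prequel, made precise here: (9.8.2.4)/(9.8.2.5) are suprema over the GENERATING tuples `ξ_z`, `z ∈ Σ̃_{L′}`,
of INTRINSIC norms (taken in the residue fields `K_{y_j,w}` of the arithmeticoids `y_j` themselves, where the valuation
scaling Thm. 4.2.2.1 (4) lives — before any collation), whereas the tensor sizes are suprema of CODOMAIN norms over the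
locus (after collation and convex closure). Print asserts no comparison between the two; Cor. 9.8.2.6's printed proof
controls the codomain sizes (DERIVED below: `tensorSize_bddAbove`) and is TYPED AS A CLAIM for the intrinsic ones
(`ProdSizeBounded`, `PlaceSizeBounded`). No adjudication.

INTERFACE with E-t4's landed `ATS3.LocusDatum ℓ*` (p428048; the real numbers §9.9–9.11 read per place `w`): `toLocusDatum`
sends this signature's standard norms `|log_BK(ξ_{w,j})|` at `z_Θ` and the `w`-component sup (9.8.2.4) to `theta` /
`supNorm`; the q-side number `|q_w^{1/2ℓ}| ∈ (0,1)` and the hull volume (§9.10) do NOT occur in §9.8 and are ARGUMENTS. DERIVED: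
`z_Θ ∈ Σ̃_{L′}` (Thm-Def 9.8.1.1) + boundedness (Cor. 9.8.2.6, intrinsic) ⟹ E-t4's `StandardPointInLocus`, whence E-t4's
`fundamentalEstimateSup_of` applies to these objects under his `ValuationScaling` ((9.9.4)). OUR-side counterparts (hints
only; dictionary Props live in `Joshi/Dictionary*.lean`, E-PLAN R14): `|Θ̃|` ↔ `Cor312.Setting.negLogTheta` (procession-
NORMALISED log-volume of a HULL; Joshi's (9.8.2.4) is a plain sup of norms of generators — his `1/ℓ*` enters at Cor. 9.11.1.1,
his volumes in §9.10: T-23). [claim: Joshi2024ATS3, status: disputed]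
-/

noncomputable section

open Set

namespace Summit.ABC.IUTFork.Joshi.ATS3

namespace TensorPacketLociDatum

variable {W : Type} {V : W → Type} [∀ w, TopologicalSpace (V w)] {TJ TM : Type} [TopologicalSpace TJ]
  [TopologicalSpace TM] (C : TensorPacketLociDatum W V TJ TM)

/-! ## 1. (9.8.2.1)–(9.8.2.2): norms of classes and of the two tuples -/

/-- **(9.8.2.1)** `|log_BK(ξ_y)| := ∏_{w ∈ 𝕍^{odd,ss}} |log_BK(ξ_{y,w})|_{K_{y_w}}` (p.117 l.15–36; the product over ALL places
reduces to this one: `finprod_nrm_xi`). Norms are taken in the residue fields of `y` ITSELF (FLAG (iii)).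
[claim: Joshi2024ATS3, status: disputed] -/
def classNorm (y : C.Y) : ℝ := ∏ w ∈ C.Wss, C.nrm y w (C.xi y w)

/-- At places outside `𝕍^{odd,ss}` the class is the unit class `(1+p*_w)^{1/p^n}` ((9.7.4.2) p.112 l.12–19), of unit norm
after the division by `p*_w` in (9.7.2.2) (Rmk. 9.8.2.3 via Lemma 9.8.2.7) — the reason for the second `=` of (9.8.2.1).
READING PREDICATE. [claim: Joshi2024ATS3, status: disputed] -/
@[claim "Joshi2024ATS3" "disputed"]
def UnitNormOffSS : Prop := ∀ (y : C.Y) (w : W), w ∉ C.Wss → C.nrm y w (C.xi y w) = 1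

/-- **Rmk. 9.8.2.3** (p.117 l.63–80): «by Lemma 9.8.2.7, `|log_p(1+p*_w)|_{L′_w} = |p*_w|` for all `w`. So `log_BK(1+p*)`
contributes an element of unit norm.» READING PREDICATE. [claim: Joshi2024ATS3, status: disputed] -/
@[claim "Joshi2024ATS3" "disputed"]
def OneUnitNorm : Prop := ∀ (y : C.Y) (w : W), C.nrm y w (C.one y w) = 1

/-- (9.8.2.1), second equality, DERIVED: under `UnitNormOffSS` the product over all places is the finite product over
`𝕍^{odd,ss}`. [folklore] -/
theorem finprod_nrm_xi (h : C.UnitNormOffSS) (y : C.Y) : ∏ᶠ w, C.nrm y w (C.xi y w) = C.classNorm y := by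
  unfold classNorm
  refine finprod_eq_prod_of_mulSupport_subset _ fun w hw => ?_
  by_contra hw'
  exact hw (h y w (by simpa using hw'))

/-- **(9.8.2.2)** `|log_BK(ξ^{Joshi}_z)| := ∏_{j=1}^{ℓ*} |log_BK(ξ_{y_j})|` (p.117 l.37–59). [claim: Joshi2024ATS3, status: disputed] -/
def tupleNormJ (z : C.Z) : ℝ := ∏ i : Fin C.lstar, C.classNorm (C.pt z i)

/-- `|log_BK(ξ^{Mochizuki}_z)|`, «similarly» (p.117 l.60–62): the product over labels `j` and over `a ∈ S_{j+1}` of the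
norms of the components of `ξ^{Mochizuki}_z`. [claim: Joshi2024ATS3, status: disputed] -/
def tupleNormM (z : C.Z) : ℝ :=
  ∏ i : Fin C.lstar, ∏ a : Fin ((i : ℕ) + 2), ∏ w ∈ C.Wss, C.nrm (C.extAt z i a) w (C.xiM z i a w)

/-- Rmk. 9.8.2.3 DERIVED consequence: the unit classes contribute norm `1`, so `|log_BK(ξ^{Mochizuki}_z)| =
|log_BK(ξ^{Joshi}_z)|`. [folklore] -/
theorem tupleNormM_eq_tupleNormJ (h : C.OneUnitNorm) (z : C.Z) : C.tupleNormM z = C.tupleNormJ z := by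
  unfold tupleNormM tupleNormJ
  refine Finset.prod_congr rfl fun i _ => ?_
  rw [Finset.prod_eq_single (Fin.last ((i : ℕ) + 1))]
  · unfold classNorm
    refine Finset.prod_congr rfl fun w _ => ?_
    simp only [xiM, Fin.val_last, if_true]
    rfl
  · intro a _ ha
    have ha' : (a : ℕ) ≠ (i : ℕ) + 1 := fun e => ha (Fin.ext (by simp [e]))
    refine Finset.prod_eq_one fun w _ => ?_
    simp only [xiM, ha', if_false]
    exact h _ _
  · intro hn; exact absurd (Finset.mem_univ _) hn

/-! ## 2. (9.8.2.4)/(9.8.2.5), the tensor sizes, Corollary 9.8.2.6 -/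

/-- **(9.8.2.4)** `|Θ̃^{Ĩ}_Joshi| := sup_{z ∈ Σ̃_{L′}} {|log_BK(ξ^{Joshi}_z)|}` (p.117 l.81–94) — a supremum over the
GENERATING tuples (real `sSup`; meaningful under `ProdSizeBounded`). [claim: Joshi2024ATS3, status: disputed] -/
def prodSizeJ : ℝ := sSup (Set.range C.tupleNormJ)

/-- **(9.8.2.5)** `|Θ̃^{Ĩ}_Mochizuki| := sup_{z ∈ Σ̃_{L′}} {|log_BK(ξ^{Mochizuki}_z)|}` (p.117 l.95–108).
[claim: Joshi2024ATS3, status: disputed] -/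
def prodSizeM : ℝ := sSup (Set.range C.tupleNormM)

/-- The `w`-component size `|Θ̃_{Joshi,w}| = sup_z ∏_j |log_BK(ξ_{y_j,w})|_{K_{y_{j,w}}}` (p.119 l.123–127 «one may work
with components … for each `w` … and then take product over all `w`») — the number E-t4's `ATS3.LocusDatum.supNorm` reads
at `w`. [claim: Joshi2024ATS3, status: disputed] -/
def placeSizeJ (w : W) : ℝ := sSup (Set.range fun z : C.Z => ∏ i : Fin C.lstar, C.nrm (C.pt z i) w (C.xi (C.pt z i) w))

/-- `|log_BK(ξ_{w,j})|` at the STANDARD point `z_Θ` — the numbers E-t4's `ATS3.LocusDatum.theta` reads ((9.9.2)–(9.9.4)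
are about these). [claim: Joshi2024ATS3, status: disputed] -/
def standardNorm (w : W) (i : Fin C.lstar) : ℝ := C.nrm (C.pt C.zTheta i) w (C.xi (C.pt C.zTheta i) w)

/-- `|Θ̃^{𝓘}_Joshi|` := the supremum of the tensor-product norms of the elements of `Θ̃^{𝓘}_Joshi` (p.117 l.109–126).
[claim: Joshi2024ATS3, status: disputed] -/
def tensorSizeJ : ℝ := sSup (C.tnrmJ '' C.thetaLocusTensorJ)

/-- `|Θ̃^{𝓘}_Mochizuki|` := the supremum of the tensor-product norms over `Θ̃^{𝓘}_Mochizuki`. [claim: Joshi2024ATS3, status: disputed] -/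
def tensorSizeM : ℝ := sSup (C.tnrmM '' C.thetaLocusTensorM)

/-- **Cor. 9.8.2.6, intrinsic part** («the suprema `|Θ̃^{Ĩ}_Joshi|`, `|Θ̃^{Ĩ}_Mochizuki|` are bounded», p.117 l.127–156):
READING PREDICATE — the printed proof («clear from Corollary 9.8.1.3») controls CODOMAIN norms over the locus, whereas
(9.8.2.4)/(9.8.2.5) take intrinsic norms of the generators before collation (FLAG (iii)); typed as a claim, not derived.
[claim: Joshi2024ATS3, status: disputed] -/
@[claim "Joshi2024ATS3" "disputed"]
def ProdSizeBounded : Prop := BddAbove (Set.range C.tupleNormJ) ∧ BddAbove (Set.range C.tupleNormM)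

/-- **Cor. 9.8.2.6, tensor part, DERIVED** as printed: a continuous norm is bounded on a subset of a compact set
(Cor. 9.8.1.3). [folklore] -/
theorem tensorSize_bddAbove (hJ : C.LocusInShellsJ) (hM : C.LocusInShellsM) :
    BddAbove (C.tnrmJ '' C.thetaLocusTensorJ) ∧ BddAbove (C.tnrmM '' C.thetaLocusTensorM) := by
  refine ⟨?_, ?_⟩
  · exact ((C.isCompact_shellsJ.image C.toTensorJ_continuous).bddAbove_image
      C.tnrmJ_continuous.continuousOn).mono (image_mono (image_mono hJ))
  · exact ((C.isCompact_shellsM.image C.toTensorM_continuous).bddAbove_image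
      C.tnrmM_continuous.continuousOn).mono (image_mono (image_mono hM))

/-- Under boundedness the size dominates the norm of every generating tuple — in particular of `ξ_{z_Θ}`, the one element the
proof of Thm. 9.9.1 exhibits (p.119 l.73–85). [folklore] -/
theorem tupleNormJ_le_prodSizeJ (h : C.ProdSizeBounded) (z : C.Z) : C.tupleNormJ z ≤ C.prodSizeJ :=
  le_csSup h.1 ⟨z, rfl⟩

/-- The same for `|Θ̃^{Ĩ}_Mochizuki|`. [folklore] -/
theorem tupleNormM_le_prodSizeM (h : C.ProdSizeBounded) (z : C.Z) : C.tupleNormM z ≤ C.prodSizeM :=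
  le_csSup h.2 ⟨z, rfl⟩

/-- Rmk. 9.8.2.3 ⟹ the two product sizes coincide. [folklore] -/
theorem prodSizeM_eq_prodSizeJ (h : C.OneUnitNorm) : C.prodSizeM = C.prodSizeJ := by
  unfold prodSizeM prodSizeJ
  congr 1
  exact congrArg Set.range (funext (C.tupleNormM_eq_tupleNormJ h))

/-! ## 3. The `w`-components and the projection to E-t4's `ATS3.LocusDatum` -/

/-- **Cor. 9.8.2.6 per place, intrinsic form**: the `w`-component sup (9.8.2.4) is finite. READING PREDICATE (see FLAG (iii)).
[claim: Joshi2024ATS3, status: disputed] -/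
@[claim "Joshi2024ATS3" "disputed"]
def PlaceSizeBounded (w : W) : Prop :=
  BddAbove (Set.range fun z : C.Z => ∏ i : Fin C.lstar, C.nrm (C.pt z i) w (C.xi (C.pt z i) w))

/-- `z_Θ ∈ Σ̃_{L′}` ⟹ the `w`-component size dominates `∏_j |log_BK(ξ_{w,j})|` at the standard point — the inequality the proof
of Thm. 9.9.1 reads off (p.119 l.73–102 «the inequality … will follow if the absolute value of this chosen element bounds above
the quantity on the right»). [folklore] -/
theorem prod_standardNorm_le_placeSizeJ (w : W) (h : C.PlaceSizeBounded w) :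
    ∏ i : Fin C.lstar, C.standardNorm w i ≤ C.placeSizeJ w :=
  le_csSup h ⟨C.zTheta, rfl⟩

/-- **Projection to E-t4's `ATS3.LocusDatum ℓ*`** (p428048): `theta := |log_BK(ξ_{w,j})|` at `z_Θ` (`standardNorm`), `supNorm :=`
the `w`-component of (9.8.2.4) (`placeSizeJ`); the q-side number `|q_w^{1/2ℓ}| ∈ (0,1)` (Thm. 9.9.1) and the weighted hull
volume `Vol(Θ̃^{𝓘}_{Mochizuki,w})` (§9.10, T-23) are not §9.8 data and are supplied by the caller. [claim: Joshi2024ATS3, status: disputed] -/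
def toLocusDatum (w : W) (qroot : ℝ) (hq0 : 0 < qroot) (hq1 : qroot < 1) (hullVol : ℝ) : LocusDatum C.lstar where
  qroot := qroot
  qroot_pos := hq0
  qroot_lt_one := hq1
  theta := C.standardNorm w
  supNorm := C.placeSizeJ w
  hullVol := hullVol

/-- Thm-Def 9.8.1.1 (`z_Θ ∈ Σ̃_{L′}`) + Cor. 9.8.2.6 (intrinsic, at `w`) ⟹ E-t4's input `StandardPointInLocus` for the projected
datum. [folklore] -/
theorem toLocusDatum_standardPointInLocus (w : W) (h : C.PlaceSizeBounded w) (qroot : ℝ) (hq0 : 0 < qroot)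
    (hq1 : qroot < 1) (hullVol : ℝ) : (C.toLocusDatum w qroot hq0 hq1 hullVol).StandardPointInLocus :=
  C.prod_standardNorm_le_placeSizeJ w h

/-- Hence E-t4's proved spine applies to these objects: (9.9.4) valuation scaling at the standard point (E-t4's
`ValuationScaling` of the projection) + boundedness ⟹ Thm. 9.9.1's `w`-component `|q_w^{1/2ℓ}|^{ℓ*} ≤ |Θ̃_{Joshi,w}|`
(`LocusDatum.fundamentalEstimateSup_of`, p428048). [claim: Joshi2024ATS3, status: disputed] -/
theorem fundamentalEstimateSup_of_scaling (w : W) (h : C.PlaceSizeBounded w) (qroot : ℝ) (hq0 : 0 < qroot)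
    (hq1 : qroot < 1) (hullVol : ℝ) (hsc : (C.toLocusDatum w qroot hq0 hq1 hullVol).ValuationScaling) :
    (C.toLocusDatum w qroot hq0 hq1 hullVol).FundamentalEstimateSup :=
  (C.toLocusDatum w qroot hq0 hq1 hullVol).fundamentalEstimateSup_of hsc
    (C.toLocusDatum_standardPointInLocus w h qroot hq0 hq1 hullVol)

end TensorPacketLociDatum

/-! ## 4. Lemma 9.8.2.7 -/

/-- **Lemma 9.8.2.7** (p.117 l.159 – p.119 l.22): «Let `E` be a p-adic field and let `|−|_E` be a p-adic absolute value on
`E`. Then for all `x ∈ (p*·𝒪_E) − {0}` one has `|log_E(1+x)|_E = |x|_E`» (proof p.118: `|x^n/n| < |x|` for `n ≥ 2` since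
`|x| ≤ |p*| < |p|^{1/(p−1)}`, [Koblitz 1984, IV.1]; `p* = p`, resp. `4` if `p = 2`, (9.7.2.2)/Rmk. 9.7.1.2). Typed as a
predicate on an abstract logarithm `logE` and the element `p*` of a normed field (`x ∈ p*·𝒪_E ⟺ ‖x‖ ≤ ‖p*‖`); Mathlib has no
`p`-adic logarithm for a general `p`-adic field. READING PREDICATE. [claim: Joshi2024ATS3, status: disputed] -/
@[claim "Joshi2024ATS3" "disputed"]
def LogOnePlusNormEq (E : Type) [NormedField E] (logE : E → E) (pstar : E) : Prop :=
  ∀ x : E, x ≠ 0 → ‖x‖ ≤ ‖pstar‖ → ‖logE (1 + x)‖ = ‖x‖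

end Summit.ABC.IUTFork.Joshi.ATS3

end
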